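import Summits.QuantumFields.BalabanUV.Beta.FP.TowerLamJunctionAssembly
import Summits.QuantumFields.BalabanUV.Beta.FP.TowerLamStencilLocality
import Summits.QuantumFields.BalabanUV.Beta.FP.TorusNBindingOfJunctionsGauge
import Summits.QuantumFields.BalabanUV.Beta.FP.TorusLamJunctionShape

/-!
# `BalabanUV.Beta.FP.TowerHN1Row` — road «FP», binder row D1, ROUTE T (β1): **THE END WRAPPER's CONTENT ROW `hHN₁` AT ONE DIRECTION, FROM THE ROAD's DATA** —
# with the storey data `cf ∕ hb ∕ w ∕ κ` of `FP/TowerHLinkRows` along the pinned direction `dv = r•e_a`, the wrapper's namings `hH₁f ∕ hH′₁f` (displayed as values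
# `hH₁ ∕ hH′₁`) and its form pin `hH₀`, the first-order H-side jet IS the periodised N-vertex: `H′₁ = (perF T (dper T (VN (Roots.ctr Lc) Pn (n+1) μ y)))|ff`,
# GIVEN ONLY the pin `hr : (−2c)·r = Pn.cE (n+2)`, the lock row `hcΛ : 2·Pn.cΛ (n+2) = (Lc⁴)^{n+2}·Pn.cE (n+2)` (R-FP-81), the instantiation letters `hJW` ((J-W″) at
# `r := 1`, gauge function `lv e_a`), the linearity letters `hhvl ∕ hlv` of the nested column and of its tree-gauge read-out `lv`, `hfold` (an2 PART 25) and `2 ≤ Lc`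

WHY (`HOME/b2b-balaban-beta-d1-p3/g41/SPEC-52.md` §D.3).  (E4d) `TorusNBindingOfJunctionsGauge.hHN1_named_of_junctions_gauge_pin` (g39, p527137 ✓) gives the row from
(J-W″) in its `r`-form, the pin, and (J-Λ); (J-Λ) is `TorusLamJunctionShape.lamJunction_of_dper_eq` (g38) from the lattice identity `hΛN`, which `FP/TowerLamJunctionAssembly`
(g42 #1) proves at the road's data from the top word `htop : w (n+1)·r = Pn.cΛ (n+2)`; `htop` is the lock row read backwards (`TowerHLinkRowsLower.w_top` + `hr` + `hcΛ`);
the locality letters `hLS ∕ hCs ∕ hδ` are g41 #6 `TowerLamStencilLocality.exists_locStencil_SLam_cf`; the brick list `ℓ` and the storey kernels `𝒦` of the (E4b) display are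
CHOSEN here (their letters `hℓ ∕ h𝒦` are `rfl`), so they leave the statement.

WHAT ([folklore] bookkeeping BY NAME; no `def`, no `def … : Prop`, nothing cited, 0 sorry; data binders VERBATIM as in `TowerWeightWords.weight_word` ∕ `TowerLamJunctionAssembly`
at `R := Roots.ctr Lc`, with the gauge functions `lam a := lv e_a` of the wrapper's displayed read-out `lv`): §1 `htop_of_lock` (the top word from `w_top`, the pin and the
lock), `map_smul_of_linear`, `hJW_r` ((J-W″) in (E4d)'s `r`-form for `hb (n+1) := hbF (n+1) (r•e_a)`, `l := lv (r•e_a)`, from the `r := 1` letter, `hhvl`, `hlv`, `hhbF`);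
§2 **`hHN1_of_road_data`** — `H′₁ = (perF T (dper T (VN (Roots.ctr Lc) Pn (n+1) (μN a) (yN a))))|ff` for the wrapper's `hH₁ ∕ hH′₁` at `v := r•e_a`.  Displayed letters left
(all the instantiation's, none Bałaban's): the data's defining equations `hcfF hhbF hκF hwF hT′`, `hlev`, `hhvl`, `hlv`, `hJW`, `hfold`, `hH₀`, `hr`, `hcΛ`, `hLc`, `hH₁ ∕ hH′₁`.
WHAT THIS IS NOT: not the wrapper's `hHN₁` FAMILY (`∀ n μ y B`) — one direction label `a : κ` with `(μ, y) = (μN a, yN a)`, one depth, one box; not `hJW`'s instantiation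
(g39 #5 at the pins), not `hfold` (PART 25, in the tree), not the values of `Pn.cE ∕ Pn.cΛ` (rows `hr ∕ hcΛ` of the (C1) instantiation); not (E4e) `hQN₁`, not second order;
nothing of Bałaban's asserted, valued or discharged; 0 estimates; 0∕4 row-D1 binders (hW, hR, D1Tel, D1Rep); ROOT M‴ p325680 ∕ P5c ∕ D6 untouched; NOT (C1), NOT (L2′),
NOT (T-ID), NOT SDF, NOT D1, NEVER «G-an2-4 closed», NOT BetaPertH, NOT continuum, NOT Clay.

HONEST DEPENDENCY (page 1, mandatory): continuum YM on T⁴ ⇐ BetaPertH ∧ nine spine estimates (0/9 proved); BetaPertH ⇐ (D1) ∧ (D4) ∧ CAP+tail;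
G-an2-4 gates asym, D1 and NE2/3/4.  HONEST FRAMING (cell contract, verbatim): «discharging `BetaPertH` makes Bałaban's UV stability UNCONDITIONAL —
a real constructive-QFT result; it is NOT the continuum limit and NOT the Clay problem.»  ABSOLUTE RULE (cell charter, verbatim): «No internally-minted
statement may enter as a cited fact. Every hypothesis is either kernel-proved in this package or a verbatim quotation of a PUBLISHED theorem with page
reference. The manuscript(s) under audit are NOT citable for their own disputed steps — they are the thing under adjudication; programme-internal
(2001/route/tribunal) claims are never citable.»  Road «FP» OWNER, b2b-balaban-beta-d1-p3 gen 42, 2026-08-27.  No existing file touched.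
-/

noncomputable section

open scoped BigOperators

namespace Summit.QuantumFields.BalabanUV.Beta.FP.TowerHN1Row

open Finset Matrix
open Literature.MathematicalPhysics.QuantumFieldTheory
open Literature.MathematicalPhysics.QuantumFieldTheory.Balaban1983to89
open Literature.MathematicalPhysics.QuantumFieldTheory.Balaban1983to89.Beta
open B4TorusKernel.MultiPeriod (translate)
open B5Prop11Plancherel (fine)
open B6Lemma24Torus (pbox)
open AffineAveraging (Site box toSite)
open AveragingHessianKernels (Bond)
open AveragingContoursRooted (ctr ctrOff)
open ExpKernelCalculus (MKer)
open OneStepResolventKernel (Fib KInv)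
open InterLevelTransport (SLam)
open BalabanStepJets (lamCoeffOf)
open StepJetData (wilsonA)
open Summit.QuantumFields.BalabanUV.Beta.SymAveragingHessianCounts (symLinKerAt symHessFFAt)
open Summit.QuantumFields.BalabanUV.Beta.BorderedHessian (stepScale)
open Summit.QuantumFields.BalabanUV.Beta.SymShiftedSpread (bhKStepSh)
open Summit.QuantumFields.BalabanUV.Beta.DshAn1 (Dsh)
open Summit.QuantumFields.BalabanUV.Beta.CompositeVertexKernelRec (compLinKer)
open Summit.QuantumFields.BalabanUV.Beta.CompositeOneShotJets (compH)
open Summit.QuantumFields.BalabanUV.Beta.CompositeOneShotJetData (Roots Pins AN VN)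
open Summit.QuantumFields.BalabanUV.Beta.FP.KernelPeriodisationFib (Idx perF)
open Summit.QuantumFields.BalabanUV.Beta.FP.KernelPeriodisationFibLoc (dper)
open Summit.QuantumFields.BalabanUV.Beta.FP.TorusGaugeCovariance (tgrad)
open Summit.QuantumFields.BalabanUV.Beta.FP.TorusGaugeCovariancePairing (wrapPt wrapPt_of_mem)
open Summit.QuantumFields.BalabanUV.Beta.FP.TorusCompositeObjects (towerTorus)
open Summit.QuantumFields.BalabanUV.Beta.FP.TorusCompositeCompanionSumG (compSumSym)
open Summit.QuantumFields.BalabanUV.Beta.FP.TorusCompositeCompanionFamilyG (onTowerFamily)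
open Summit.QuantumFields.BalabanUV.Beta.FP.TowerHLinkRowsLower (w_top)
open Summit.QuantumFields.BalabanUV.Beta.FP.TowerLamStencilLocality (exists_locStencil_SLam_cf)
open Summit.QuantumFields.BalabanUV.Beta.FP.TowerLamJunctionAssembly (dper_sum_storeyKernels_eq_dper_lamN)
open Summit.QuantumFields.BalabanUV.Beta.FP.TorusLamJunctionShape (lamJunction_of_dper_eq)
open Summit.QuantumFields.BalabanUV.Beta.FP.TorusNBindingOfJunctionsGauge (hHN1_named_of_junctions_gauge_pin)

variable {Lc : ℕ} [NeZero Lc] (n : ℕ) (M : Fin (3 + 1) → ℕ) [∀ i, NeZero (M i)]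

/-! ## §1 The top word from the lock; (J-W″) in its `r`-form -/

section Scalars

variable (c : ℝ) (κF wF : ℕ → ℝ)
  (hκF : ∀ k, κF k = ∏ i ∈ Finset.Ico k (n + 1), (stepScale 3 Lc (n + 1 - (i + 1)) * ((box (3 + 1) Lc).card : ℝ)))
  (hwF : ∀ k, wF k = (-(c * ((Lc : ℝ) ^ (3 + 1)) ^ (n + 1 + 1))
      / ∏ i ∈ Finset.Ico k (n + 1), (stepScale 3 Lc (n + 1 - (i + 1)) * (Lc : ℝ) ^ (3 + 1))) / κF k)

omit [NeZero Lc] in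
include hκF hwF in
/-- [folklore] **`htop_of_lock` — THE TOP WORD FROM THE LOCK** (R-FP-81 read backwards): `w (n+1) = −c·(Lc⁴)^{n+2}` (`TowerHLinkRowsLower.w_top`), the pin
`(−2c)·r = cE` and the lock row `2·cΛ = (Lc⁴)^{n+2}·cE` give `w (n+1)·r = cΛ` (`TowerLamJunctionAssembly`'s `htop`). -/
theorem htop_of_lock (r cE cΛ : ℝ) (hr : (-2 * c) * r = cE) (hcΛ : 2 * cΛ = ((Lc : ℝ) ^ (3 + 1)) ^ (n + 1 + 1) * cE) : wF (n + 1) * r = cΛ := by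
  rw [w_top n c κF wF hκF hwF]
  linear_combination (-(1 : ℝ) / 2) * hcΛ + (((Lc : ℝ) ^ (3 + 1)) ^ (n + 1 + 1) / 2) * hr

end Scalars

section Row

variable (P : Pins) (N₁ : ℕ) [NeZero N₁] (lev : ℕ → ℕ) (hlev : ∀ i ≤ n + 1, lev i = n + 1 - i) (rs : ℕ → (Fin (3 + 1) → ℕ))
  -- the road's storey data (as in `TowerWeightWords.weight_word`, at `R := Roots.ctr Lc`)
  {κ : Type*} [Fintype κ] [DecidableEq κ] (yN : κ → Site (3 + 1)) (μN : κ → Fin (3 + 1))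
  (hv : (κ → ℝ) → (↥(pbox (towerTorus Lc (fine Lc M) (n + 1))) × Fin (3 + 1) → ℝ))
  (cfF : ℕ → Fin (3 + 1) → Site (3 + 1) → Fin (3 + 1) → Site (3 + 1) → ℝ)
  (hcfF : ∀ (k : ℕ) (μ : Fin (3 + 1)) (s : Site (3 + 1)) (κ' : Fin (3 + 1)) (x : Site (3 + 1)), cfF k μ s κ' x
    = if k = n + 1 then
        ∑ ν : Fin (3 + 1), ∑' w : Site (3 + 1), lamCoeffOf (KInv (N := Lc ^ (n + 1 + 1)) (d := 3)) (Lc ^ (n + 1 + 1)) ν w κ' x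
          * compLinKer (fun _ => symLinKerAt (toSite (Roots.ctr Lc).r) Lc) Lc (n + 1) (μ, s) (ν, w)
      else (if x = (Lc : ℤ) • s ∧ κ' = μ then (1 : ℝ) else 0))
  (hbF : (k : ℕ) → (κ → ℝ) → (↥(pbox (towerTorus Lc (fine Lc M) k)) × Fin (3 + 1) → ℝ))
  (hhbF : ∀ (k : ℕ) (v : κ → ℝ) (ā : ↥(pbox (towerTorus Lc (fine Lc M) k)) × Fin (3 + 1)), hbF k v ā
    = if k = n + 1 then hv v (wrapPt (towerTorus Lc (fine Lc M) (n + 1)) (ā.1 : Site (3 + 1)), ā.2)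
      else ∑ y₀ : ↥(pbox (towerTorus Lc M k)), (if (ā.1 : Site (3 + 1)) = (Lc : ℤ) • (y₀ : Site (3 + 1)) then
        ∑ a : κ, v a * ∑' nn : Site (3 + 1), ∑ ν : Fin (3 + 1), ∑' w : Site (3 + 1),
          (∑ κ' : Fin (3 + 1), ∑' u' : Site (3 + 1),
              AN (Roots.ctr Lc) (n + 1) u' (((Lc ^ (n + 1 + 1) : ℕ) : ℤ) • yN a) (Sum.inl κ') (Sum.inr (μN a))
                * lamCoeffOf (KInv (N := Lc ^ (n + 1 + 1)) (d := 3)) (Lc ^ (n + 1 + 1)) ν w κ' u')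
            * compLinKer (fun _ => symLinKerAt (toSite (Roots.ctr Lc).r) Lc) Lc k (ā.2, translate (towerTorus Lc M k) (y₀ : Site (3 + 1)) nn) (ν, w)
        else 0))
  (c : ℝ) (κF wF : ℕ → ℝ)
  (hκF : ∀ k, κF k = ∏ i ∈ Finset.Ico k (n + 1), (stepScale 3 Lc (n + 1 - (i + 1)) * ((box (3 + 1) Lc).card : ℝ)))
  (hwF : ∀ k, wF k = (-(c * ((Lc : ℝ) ^ (3 + 1)) ^ (n + 1 + 1))
      / ∏ i ∈ Finset.Ico k (n + 1), (stepScale 3 Lc (n + 1 - (i + 1)) * (Lc : ℝ) ^ (3 + 1))) / κF k)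
  (T' : Fin (3 + 1) → ℕ) (hT' : ∀ i, towerTorus Lc (fine Lc M) (n + 1) i = Lc * T' i)
  (hhvl : ∀ (r : ℝ) (x y : κ → ℝ), hv (r • x + y) = r • hv x + hv y)
  -- the wrapper's tree-gauge read-out `lv` (linear, `hlv`); the gauge function of the source `e_a` is `lv e_a`
  (lv : (κ → ℝ) → ↥(pbox (towerTorus Lc (fine Lc M) (n + 1))) → ℝ)
  (hlv : ∀ (r : ℝ) (x y : κ → ℝ), lv (r • x + y) = r • lv x + lv y)
  (hJW : ∀ (a : κ) (b : ↥(pbox (towerTorus Lc (fine Lc M) (n + 1))) × Fin (3 + 1)), hv (Pi.single a 1) b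
      = perF (towerTorus Lc (fine Lc M) (n + 1)) (AN (Roots.ctr Lc) (n + 1)) (b.1, Sum.inl b.2)
          (wrapPt (towerTorus Lc (fine Lc M) (n + 1)) (((Lc ^ (n + 1 + 1) : ℕ) : ℤ) • yN a), Sum.inr (μN a))
        - ∑ s : ↥(pbox (towerTorus Lc (fine Lc M) (n + 1))), tgrad (towerTorus Lc (fine Lc M) (n + 1)) (b.1, Sum.inl b.2) s * lv (Pi.single a 1) s)
  (hfold : ∀ (μ : Fin (3 + 1)) (y : Site (3 + 1)) (κ₁ : Fin (3 + 1)) (s₁ : Site (3 + 1)),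
      ∑ ā : ↥(pbox (towerTorus Lc (fine Lc M) (n + 1))) × Fin (3 + 1),
          perF (towerTorus Lc (fine Lc M) (n + 1)) (AN (Roots.ctr Lc) (n + 1)) (ā.1, Sum.inl ā.2)
              (wrapPt (towerTorus Lc (fine Lc M) (n + 1)) (((Lc ^ (n + 1 + 1) : ℕ) : ℤ) • y), Sum.inr μ)
            * (∑' m : Site (3 + 1), ∑ ν : Fin (3 + 1), ∑' w : Site (3 + 1),
                lamCoeffOf (KInv (N := Lc ^ (n + 1 + 1)) (d := 3)) (Lc ^ (n + 1 + 1)) ν w ā.2 (ā.1 : Site (3 + 1))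
                  * compLinKer (fun _ => symLinKerAt (toSite (Roots.ctr Lc).r) Lc) Lc (n + 1) (κ₁, translate T' s₁ m) (ν, w))
        = ∑' m : Site (3 + 1), ∑ ν : Fin (3 + 1), ∑' w : Site (3 + 1),
            (∑ κ' : Fin (3 + 1), ∑' u' : Site (3 + 1),
                AN (Roots.ctr Lc) (n + 1) u' (((Lc ^ (n + 1 + 1) : ℕ) : ℤ) • y) (Sum.inl κ') (Sum.inr μ)
                  * lamCoeffOf (KInv (N := Lc ^ (n + 1 + 1)) (d := 3)) (Lc ^ (n + 1 + 1)) ν w κ' u')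
              * compLinKer (fun _ => symLinKerAt (toSite (Roots.ctr Lc).r) Lc) Lc (n + 1) (κ₁, translate T' s₁ m) (ν, w))
  -- the pinned direction `dv = r•e_a`: the pin `(−2c)·r = cE (n+2)` and the LOCK ROW (R-FP-81)
  (r : ℝ) (hr : (-2 * c) * r = P.cE (n + 1 + 1)) (hcΛ : 2 * P.cΛ (n + 1 + 1) = ((Lc : ℝ) ^ (3 + 1)) ^ (n + 1 + 1) * P.cE (n + 1 + 1)) (a : κ)
  -- the wrapper's form pin at the finest storey
  {H₀ : Matrix (↥(pbox (towerTorus Lc (fine Lc M) (n + 1))) × Fin (3 + 1)) (↥(pbox (towerTorus Lc (fine Lc M) (n + 1))) × Fin (3 + 1)) ℝ}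
  (hH₀ : H₀ = (perF (towerTorus Lc (fine Lc M) (n + 1)) (bhKStepSh 3 Lc (Dsh Lc) 0)).submatrix
      (fun b : ↥(pbox (towerTorus Lc (fine Lc M) (n + 1))) × Fin (3 + 1) => ((b.1, Sum.inl b.2) : Idx (towerTorus Lc (fine Lc M) (n + 1)) (Fib 3)))
      (fun b : ↥(pbox (towerTorus Lc (fine Lc M) (n + 1))) × Fin (3 + 1) => ((b.1, Sum.inl b.2) : Idx (towerTorus Lc (fine Lc M) (n + 1)) (Fib 3))))
  (hLc : 2 ≤ Lc)

omit [NeZero Lc] [∀ i, NeZero (M i)] [Fintype κ] [DecidableEq κ] in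
/-- [folklore] a map of the source that is linear in the displayed sense (`f (r•x + y) = r•f x + f y`) is homogeneous: `f (r•x) = r•f x` (`f 0 = 0` first). -/
theorem map_smul_of_linear {X : Type*} [AddCommGroup X] [Module ℝ X] (f : (κ → ℝ) → X) (hf : ∀ (r : ℝ) (x y : κ → ℝ), f (r • x + y) = r • f x + f y)
    (r : ℝ) (x : κ → ℝ) : f (r • x) = r • f x := by
  have h0 : f 0 = 0 := by
    have h := hf 1 0 0
    rw [one_smul, add_zero, one_smul] at h
    exact add_right_cancel (h.symm.trans (zero_add _).symm)
  have h := hf r x 0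
  rwa [add_zero, h0, add_zero] at h

include hhvl hlv hhbF hJW in
/-- [folklore] **`hJW_r` — (J-W″) IN (E4d)'s `r`-FORM**: along `dv = r•e_a` the finest storey direction `hb (n+1) := hbF (n+1) (r•e_a)` is `r·colN̂_a − tgrad·lv (r•e_a)`
termwise (`hhbF` at the top, the homogeneity of `hv` and `lv`, the `r := 1` letter `hJW`). -/
theorem hJW_r (b : ↥(pbox (towerTorus Lc (fine Lc M) (n + 1))) × Fin (3 + 1)) :
    (fun k => hbF k (r • (Pi.single a (1 : ℝ) : κ → ℝ))) (n + 1) b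
      = r * perF (towerTorus Lc (fine Lc M) (n + 1)) (AN (Roots.ctr Lc) (n + 1)) (b.1, Sum.inl b.2)
          (wrapPt (towerTorus Lc (fine Lc M) (n + 1)) (((Lc ^ (n + 1 + 1) : ℕ) : ℤ) • yN a), Sum.inr (μN a))
        - ∑ s : ↥(pbox (towerTorus Lc (fine Lc M) (n + 1))), tgrad (towerTorus Lc (fine Lc M) (n + 1)) (b.1, Sum.inl b.2) s
            * lv (r • (Pi.single a (1 : ℝ) : κ → ℝ)) s := by
  show hbF (n + 1) (r • (Pi.single a (1 : ℝ) : κ → ℝ)) b = _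
  rw [hhbF, if_pos rfl, wrapPt_of_mem, Prod.mk.eta, map_smul_of_linear hv hhvl, map_smul_of_linear lv hlv, Pi.smul_apply, smul_eq_mul, hJW a b,
    mul_sub, Finset.mul_sum]
  congr 1
  exact Finset.sum_congr rfl fun s _ => by rw [Pi.smul_apply, smul_eq_mul]; ring

include hlev hcfF hhbF hκF hwF hT' hhvl hlv hJW hfold hr hcΛ hH₀ hLc in
/-- [folklore] **`hHN1_of_road_data` — THE ROW `hHN₁` AT THE DIRECTION `(μN a, yN a)`, FROM THE ROAD's DATA**: with the wrapper's namings at `v := r•e_a` displayed as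
values — `hH₁` (the `hH₁f` right side with `hb k := hbF k (r•e_a)`, `cf := cfF`, `w := wF`) and `hH′₁` (the `hH′₁f` right side, `X = −(c • diagonal (lv v ∘ pr))`) —
**`H′₁ = (perF T (dper T (VN (Roots.ctr Lc) Pn (n+1) (μN a) (yN a))))|ff`**: (E4d) `hHN1_named_of_junctions_gauge_pin` fed with `hJW_r`, the pin, and (J-Λ) =
`lamJunction_of_dper_eq` at the CHOSEN display `ℓ ∕ 𝒦` (letters `rfl`), its `hΛN` = `TowerLamJunctionAssembly.dper_sum_storeyKernels_eq_dper_lamN` at `htop := htop_of_lock`,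
its `hLS ∕ hCs ∕ hδ` = `TowerLamStencilLocality.exists_locStencil_SLam_cf`. -/
theorem hHN1_of_road_data
    {H₁ H'₁ : Matrix (↥(pbox (towerTorus Lc (fine Lc M) (n + 1))) × Fin (3 + 1)) (↥(pbox (towerTorus Lc (fine Lc M) (n + 1))) × Fin (3 + 1)) ℝ}
    (hH₁ : H₁ = ((-2 * c) • ∑ b : ↥(pbox (towerTorus Lc (fine Lc M) (n + 1))) × Fin (3 + 1), hbF (n + 1) (r • (Pi.single a (1 : ℝ) : κ → ℝ)) b •
          (perF (towerTorus Lc (fine Lc M) (n + 1)) (dper (towerTorus Lc (fine Lc M) (n + 1)) (wilsonA 3 b.2 (b.1 : Site (3 + 1))))).submatrix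
            (fun b : ↥(pbox (towerTorus Lc (fine Lc M) (n + 1))) × Fin (3 + 1) => ((b.1, Sum.inl b.2) : Idx (towerTorus Lc (fine Lc M) (n + 1)) (Fib 3)))
            (fun b : ↥(pbox (towerTorus Lc (fine Lc M) (n + 1))) × Fin (3 + 1) => ((b.1, Sum.inl b.2) : Idx (towerTorus Lc (fine Lc M) (n + 1)) (Fib 3)))
        + wF (n + 1) • ∑ ā : ↥(pbox (towerTorus Lc (fine Lc M) (n + 1))) × Fin (3 + 1), hbF (n + 1) (r • (Pi.single a (1 : ℝ) : κ → ℝ)) ā •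
          (perF (towerTorus Lc (fine Lc M) (n + 1)) (dper (towerTorus Lc (fine Lc M) (n + 1))
            (SLam N₁ (cfF (n + 1)) (fun μ y => symHessFFAt (toSite (ctrOff (3 + 1) Lc)) Lc μ y) ā.2 (ā.1 : Site (3 + 1))))).submatrix
            (fun b : ↥(pbox (towerTorus Lc (fine Lc M) (n + 1))) × Fin (3 + 1) => ((b.1, Sum.inl b.2) : Idx (towerTorus Lc (fine Lc M) (n + 1)) (Fib 3)))
            (fun b : ↥(pbox (towerTorus Lc (fine Lc M) (n + 1))) × Fin (3 + 1) => ((b.1, Sum.inl b.2) : Idx (towerTorus Lc (fine Lc M) (n + 1)) (Fib 3)))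
        + compSumSym Lc (onTowerFamily Lc (fine Lc M) (fun k => wF k • ∑ ā : ↥(pbox (towerTorus Lc (fine Lc M) k)) × Fin (3 + 1),
            hbF k (r • (Pi.single a (1 : ℝ) : κ → ℝ)) ā •
          (perF (towerTorus Lc (fine Lc M) k) (dper (towerTorus Lc (fine Lc M) k)
            (SLam N₁ (cfF k) (fun μ y => symHessFFAt (toSite (ctrOff (3 + 1) Lc)) Lc μ y) ā.2 (ā.1 : Site (3 + 1))))).submatrix
            (fun b : ↥(pbox (towerTorus Lc (fine Lc M) k)) × Fin (3 + 1) => ((b.1, Sum.inl b.2) : Idx (towerTorus Lc (fine Lc M) k) (Fib 3)))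
            (fun b : ↥(pbox (towerTorus Lc (fine Lc M) k)) × Fin (3 + 1) => ((b.1, Sum.inl b.2) : Idx (towerTorus Lc (fine Lc M) k) (Fib 3))))) (fine Lc M) lev rs (n + 1)))
    (hH'₁ : H'₁ = -((-(c • Matrix.diagonal (fun b : ↥(pbox (towerTorus Lc (fine Lc M) (n + 1))) × Fin (3 + 1) => lv (r • (Pi.single a (1 : ℝ) : κ → ℝ)) b.1)))ᵀ * H₀)
        + H₁ + H₀ * (-(c • Matrix.diagonal (fun b : ↥(pbox (towerTorus Lc (fine Lc M) (n + 1))) × Fin (3 + 1) => lv (r • (Pi.single a (1 : ℝ) : κ → ℝ)) b.1)))) :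
    H'₁ = (perF (towerTorus Lc (fine Lc M) (n + 1)) (dper (towerTorus Lc (fine Lc M) (n + 1)) (VN (Roots.ctr Lc) P (n + 1) (μN a) (yN a)))).submatrix
          (fun b : ↥(pbox (towerTorus Lc (fine Lc M) (n + 1))) × Fin (3 + 1) => ((b.1, Sum.inl b.2) : Idx (towerTorus Lc (fine Lc M) (n + 1)) (Fib 3)))
          (fun b : ↥(pbox (towerTorus Lc (fine Lc M) (n + 1))) × Fin (3 + 1) => ((b.1, Sum.inl b.2) : Idx (towerTorus Lc (fine Lc M) (n + 1)) (Fib 3))) := by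
  -- the locality letters of the road's Λ tables (g41 #6)
  obtain ⟨δ, hδ, Cs, hCs, hLS⟩ := exists_locStencil_SLam_cf (Roots.ctr Lc) n N₁ cfF hcfF
  -- (E4d), fed with (J-W″) in its `r`-form, the pin, and (J-Λ) from the lattice identity at the road's data
  exact hHN1_named_of_junctions_gauge_pin (Roots.ctr Lc) P N₁ n M lev rs (fun μ y => symHessFFAt (toSite (ctrOff (3 + 1) Lc)) Lc μ y) cfF wF c r
    (fun k => hbF k (r • (Pi.single a (1 : ℝ) : κ → ℝ))) hH₀ (lv (r • (Pi.single a (1 : ℝ) : κ → ℝ))) (μN a) (yN a) hr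
    (hJW_r n M yN μN hv hbF hhbF hhvl lv hlv hJW r a)
    (lamJunction_of_dper_eq (Roots.ctr Lc) P N₁ n M lev rs
      (fun i μ y g => stepScale 3 Lc (lev (n + 1 - i)) * ((Lc : ℝ) ^ (3 + 1) * symLinKerAt (ctr (3 + 1) Lc) Lc μ y g))
      (fun μ y => symHessFFAt (toSite (ctrOff (3 + 1) Lc)) Lc μ y) cfF wF (fun k => hbF k (r • (Pi.single a (1 : ℝ) : κ → ℝ))) hLS hCs hδ
      (fun _ _ _ _ _ => rfl)
      (𝒦 := fun j β β' b b' => ∑ a₁ : Fin (3 + 1), ∑ a₁' : Fin (3 + 1), ∑' γ : Site (3 + 1), ∑' γ' : Site (3 + 1),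
        compLinKer (fun i μ y g => stepScale 3 Lc (lev (n + 1 - i)) * ((Lc : ℝ) ^ (3 + 1) * symLinKerAt (ctr (3 + 1) Lc) Lc μ y g)) Lc (n + 1 - j) (b, β) (a₁, γ)
          * (wF j * ∑ ā : ↥(pbox (towerTorus Lc (fine Lc M) j)) × Fin (3 + 1),
              hbF j (r • (Pi.single a (1 : ℝ) : κ → ℝ)) ā
                * SLam N₁ (cfF j) (fun μ' y' => symHessFFAt (toSite (ctrOff (3 + 1) Lc)) Lc μ' y') ā.2 (ā.1 : Site (3 + 1)) γ γ' (Sum.inl a₁) (Sum.inl a₁'))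
          * compLinKer (fun i μ y g => stepScale 3 Lc (lev (n + 1 - i)) * ((Lc : ℝ) ^ (3 + 1) * symLinKerAt (ctr (3 + 1) Lc) Lc μ y g)) Lc (n + 1 - j)
              (b', β') (a₁', γ'))
      (fun _ _ _ _ _ _ => rfl) (μN a) (yN a) hLc
      (dper_sum_storeyKernels_eq_dper_lamN n M P N₁ lev hlev
        (fun i μ y g => stepScale 3 Lc (lev (n + 1 - i)) * ((Lc : ℝ) ^ (3 + 1) * symLinKerAt (ctr (3 + 1) Lc) Lc μ y g)) (fun _ _ _ _ _ => rfl)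
        yN μN hv cfF hcfF hbF hhbF c κF wF hκF hwF T' hT' hhvl (fun a' => lv (Pi.single a' 1)) hJW hfold r
        (htop_of_lock n c κF wF hκF hwF r (P.cE (n + 1 + 1)) (P.cΛ (n + 1 + 1)) hr hcΛ) a (fun _ _ _ _ _ _ => rfl)))
    hH₁ hH'₁

end Row

end Summit.QuantumFields.BalabanUV.Beta.FP.TowerHN1Row

end
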